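import Summits.Schanuel.Schanuel.Theorems.ZilberEacParamFibreCurveGapComplete
import HarnessLib

/-!
# Polynomially parametrised base curves, LIII: the rational leading ratio with a LINEAR reduced
# coordinate — reduction to a GRAPH base (gens 17–18)

HONEST FRAMING.  Cell `pub-schanuel` (Zilber's Exponential-Algebraic Closedness, case ladder;
host summit Schanuel), seat 2, gen 21.  Complement of file XXXVII: there the Bezout reduction of an
equal-degree pair with rational leading ratio (`p lc₀ + q lc₁ = 0`, `pu + qv = 1`) produced the pair
`(G, H) = (p g₀ + q g₁, u g₁ - v g₀)` with `deg G = m < n = deg H`, and the master capstone needs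
`m ≥ 2`.  When `m = 1` the reduced base `{(G(t), H(t))}` is the GRAPH `x₁ = P(x₀)`,
`P = H ∘ ((X - G₀)/G₁)`, `deg P = n` (`paramCurve_eq_graph_of_natDegree_eq_one`), so gen 18's literal
capstone `unprojectedDense_of_mmCase_of_base_eq_graph` applies under its phase condition
`Re(lc(P) i^n) ≠ 0`, `lc(P) = lc(H)/G₁^n` (`unprojectedDense_of_mmCase_of_base_eq_paramCurve_of_ratRatio_graph`);
e.g. EVERY `W` of the case over `(x₁ - x₀)² = x₀` (`(t², t² + t)`, ratio `1`, reduced base the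
parabola `x₁' = -x₀'²`).  The residual for `m = 1` is gen 18's graph equimodular class.
Mantova–Masser's question is OPEN in general (PLMS 2024 §1 p. 5); NOT Schanuel's conjecture
(neither used nor implied; EAC ⇏ SC); `EC(3,2)` stays OPEN.
-/

noncomputable section

open Filter Topology Set Complex MvPolynomial
open Literature.NumberTheory.Transcendental Literature.ModelTheory.Zilber
open Literature.ModelTheory.ExponentialFields

set_option linter.dupNamespace false

namespace Summit.Schanuel.Schanuel.Theorems

/-- A polynomial curve whose first coordinate is LINEAR is a graph: `{(G(t), H(t))} = {x₁ = P(x₀)}`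
with `P = H ∘ (G₁⁻¹ (X - G₀))`. (new) -/
theorem paramCurve_eq_graph_of_natDegree_eq_one (G H : Polynomial ℂ) (hG : G.natDegree = 1) :
    {x : Fin 2 → ℂ | ∃ t : ℂ, x 0 = G.eval t ∧ x 1 = H.eval t} =
      {x : Fin 2 → ℂ | x 1 = (H.comp (Polynomial.C (G.coeff 1)⁻¹ *
        (Polynomial.X - Polynomial.C (G.coeff 0)))).eval (x 0)} := by
  have hG1 : G.coeff 1 ≠ 0 := by
    have : G.leadingCoeff ≠ 0 := by
      intro h
      rw [Polynomial.leadingCoeff_eq_zero] at h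
      rw [h, Polynomial.natDegree_zero] at hG
      exact zero_ne_one hG
    rwa [Polynomial.leadingCoeff, hG] at this
  have hGeval : ∀ t : ℂ, G.eval t = G.coeff 1 * t + G.coeff 0 := by
    intro t
    have h := Polynomial.as_sum_range_C_mul_X_pow G
    rw [hG] at h
    conv_lhs => rw [h]
    simp [Finset.sum_range_succ, Polynomial.eval_add, Polynomial.eval_mul]
    ring
  ext x
  simp only [Set.mem_setOf_eq, Polynomial.eval_comp, Polynomial.eval_mul, Polynomial.eval_C,
    Polynomial.eval_sub, Polynomial.eval_X]
  constructor
  · rintro ⟨t, h0, h1⟩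
    rw [h1, h0, hGeval t]
    congr 1
    field_simp
    ring
  · intro hx
    refine ⟨(G.coeff 1)⁻¹ * (x 0 - G.coeff 0), ?_, hx⟩
    rw [hGeval]
    field_simp
    ring

/-- **Rational leading ratio, linear reduced coordinate.**  `deg g₀ = deg g₁ = n ≥ 1`,
`p lc₀ + q lc₁ = 0`, `p u + q v = 1`, `G = p g₀ + q g₁` LINEAR, `H = u g₁ - v g₀`; if
`Re(lc(H) (G₁⁻¹)^n i^n) ≠ 0` then EVERY `W` of Mantova–Masser's case over `{(g₀(t), g₁(t))}` has
Zariski-dense exponential points (transport to the graph base `x₁ = H(G₁⁻¹(x₀ - G₀))`, gen 18).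
[cite: MantovaMasser2023, §1 Further remarks, p. 5 (the question, open in general)] (new) -/
theorem unprojectedDense_of_mmCase_of_base_eq_paramCurve_of_ratRatio_graph (g₀ g₁ : Polynomial ℂ)
    {p q u v : ℤ} (hbez : p * u + q * v = 1) (hn : 1 ≤ g₀.natDegree)
    (heq : g₁.natDegree = g₀.natDegree)
    (hpq : (p : ℂ) * g₀.leadingCoeff + (q : ℂ) * g₁.leadingCoeff = 0)
    {G H : Polynomial ℂ} (hG : G = Polynomial.C (p : ℂ) * g₀ + Polynomial.C (q : ℂ) * g₁)
    (hH : H = Polynomial.C (u : ℂ) * g₁ - Polynomial.C (v : ℂ) * g₀) (hG1 : G.natDegree = 1)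
    (hre : (H.leadingCoeff * (G.coeff 1)⁻¹ ^ g₀.natDegree * I ^ g₀.natDegree).re ≠ 0)
    {W : Set (Fin 2 ⊕ Fin 2 → ℂ)} (hmm : MMCaseDimPiOneFree W)
    (hbase : zeroLocus ℂ (vanishingIdeal ℂ (projAdd '' (W ∩ torusLocus ℂ 2))) =
      {x : Fin 2 → ℂ | ∃ t : ℂ, x 0 = g₀.eval t ∧ x 1 = g₁.eval t}) :
    UnprojectedDense W := by
  have hHd := (natDegree_ratRed_snd g₀ g₁ hbez hn heq hpq hH).1
  set L : Polynomial ℂ := Polynomial.C (G.coeff 1)⁻¹ * (Polynomial.X - Polynomial.C (G.coeff 0))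
    with hL
  have hG1' : G.coeff 1 ≠ 0 := by
    have : G.leadingCoeff ≠ 0 := by
      intro h
      rw [Polynomial.leadingCoeff_eq_zero] at h
      rw [h, Polynomial.natDegree_zero] at hG1
      exact zero_ne_one hG1
    rwa [Polynomial.leadingCoeff, hG1] at this
  have hLdeg : L.natDegree = 1 := by
    rw [hL, Polynomial.natDegree_C_mul (inv_ne_zero hG1'), Polynomial.natDegree_X_sub_C]
  have hLlc : L.leadingCoeff = (G.coeff 1)⁻¹ := by
    rw [hL, Polynomial.leadingCoeff_mul, Polynomial.leadingCoeff_C, Polynomial.leadingCoeff_X_sub_C,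
      mul_one]
  set P : Polynomial ℂ := H.comp L with hP
  have hPdeg : P.natDegree = g₀.natDegree := by
    rw [hP, Polynomial.natDegree_comp, hLdeg, mul_one, hHd]
  have hPlc : P.leadingCoeff = H.leadingCoeff * (G.coeff 1)⁻¹ ^ g₀.natDegree := by
    rw [hP, Polynomial.leadingCoeff_comp (by rw [hLdeg]; exact one_ne_zero), hLlc, hHd]
  refine unprojectedDense_of_mmCase_of_base_eq_paramCurve_bezout g₀ g₁ hbez hG hH
    (fun W' hW' hb' => ?_) hmm hbase
  rw [paramCurve_eq_graph_of_natDegree_eq_one G H hG1] at hb'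
  exact unprojectedDense_of_mmCase_of_base_eq_graph P (by rw [hPdeg]; exact hn)
    (by rw [hPlc, hPdeg]; exact hre) hW' hb'

/-! ## Example: every surface of the case over `(x₁ - x₀)² = x₀` -/

/-- The curve `(x₁ - x₀)² = x₀` is `{(t², t² + t)}` (leading ratio `1`, reduced coordinate
`g₁ - g₀ = t` linear). (new) -/
theorem sqDiffCurve_eq_paramCurve :
    {x : Fin 2 → ℂ | (x 1 - x 0) ^ 2 = x 0} =
      {x : Fin 2 → ℂ | ∃ t : ℂ, x 0 = (Polynomial.X ^ 2 : Polynomial ℂ).eval t ∧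
        x 1 = (Polynomial.X ^ 2 + Polynomial.X : Polynomial ℂ).eval t} := by
  ext x
  simp only [Set.mem_setOf_eq, Polynomial.eval_pow, Polynomial.eval_X, Polynomial.eval_add]
  constructor
  · intro h
    exact ⟨x 1 - x 0, h.symm, by rw [h]; ring⟩
  · rintro ⟨t, h0, h1⟩
    rw [h1, h0]; ring

/-- **Every `W` of Mantova–Masser's case whose base curve is `(x₁ - x₀)² = x₀` has Zariski-dense
exponential points** (`(t², t² + t)`: equal degrees, RATIONAL ratio `1`; `p = -1`, `q = 1`, `u = 0`,
`v = 1`: `G = t` linear, `H = -t²`, reduced base the parabola `x₁' = -x₀'²` with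
`Re(-1 · i²) = 1 ≠ 0`). [cite: MantovaMasser2023, §1 Further remarks, p. 5 (the question, open in
general)] (new) -/
theorem unprojectedDense_of_mmCase_of_base_eq_sqDiffCurve {W : Set (Fin 2 ⊕ Fin 2 → ℂ)}
    (hmm : MMCaseDimPiOneFree W)
    (hbase : zeroLocus ℂ (vanishingIdeal ℂ (projAdd '' (W ∩ torusLocus ℂ 2))) =
      {x : Fin 2 → ℂ | (x 1 - x 0) ^ 2 = x 0}) :
    UnprojectedDense W := by
  rw [sqDiffCurve_eq_paramCurve] at hbase
  have hd2 : (Polynomial.X ^ 2 : Polynomial ℂ).natDegree = 2 := by simp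
  have hlc2 : (Polynomial.X ^ 2 : Polynomial ℂ).leadingCoeff = 1 := by simp
  have hG : Polynomial.C ((-1 : ℤ) : ℂ) * (Polynomial.X ^ 2 : Polynomial ℂ) +
      Polynomial.C ((1 : ℤ) : ℂ) * (Polynomial.X ^ 2 + Polynomial.X) = Polynomial.X := by
    push_cast
    simp only [map_one, map_neg, one_mul, neg_mul]
    ring
  have hH : Polynomial.C ((0 : ℤ) : ℂ) * (Polynomial.X ^ 2 + Polynomial.X : Polynomial ℂ) -
      Polynomial.C ((1 : ℤ) : ℂ) * Polynomial.X ^ 2 = -Polynomial.X ^ 2 := by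
    push_cast
    simp only [map_one, map_zero, one_mul, zero_mul]
    ring
  refine unprojectedDense_of_mmCase_of_base_eq_paramCurve_of_ratRatio_graph (Polynomial.X ^ 2)
    (Polynomial.X ^ 2 + Polynomial.X) (p := -1) (q := 1) (u := 0) (v := 1) (by norm_num)
    (by rw [hd2]; norm_num) (by rw [hd2, natDegree_X_sq_add_X])
    (by rw [hlc2, leadingCoeff_X_sq_add_X]; push_cast; ring) hG.symm hH.symm
    (by rw [Polynomial.natDegree_X]) ?_ hmm hbase
  rw [hd2, Polynomial.coeff_X_one, inv_one, one_pow, mul_one, Polynomial.leadingCoeff_neg,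
    show (Polynomial.X ^ 2 : Polynomial ℂ).leadingCoeff = 1 by simp]
  norm_num [Complex.I_sq]

end Summit.Schanuel.Schanuel.Theorems
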